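/-
Copyright (c) 2026. All rights reserved.
Released under Apache 2.0 license as described in the file LICENSE.
Authors: abc-iut cell, campaign-S prover seat abc-iut-S1 (wave 1).
-/
import Literature.IUT.LogVolume.UnitLogKernel
import HarnessLib

/-!
# Fibres of `log_p : 𝒪_K^× → log_p(𝒪_K^×)`: torsion times a small ball

Input for the log-volume `μ^log(log_p(R^×))` of [IUTchIV] Prop. 1.4 (ii) (kurims p. 13: "`R^μ ⊆ R^×` the
torsion subgroup", "`μ^log(log_p(R_i^×)) = −(1/e_i + m_i/(e_i f_i))·log(p)`") and for the
log-compatibility [AbsTopIII] Prop. 5.7 (i)(c): `log_p` is `|R^μ|`-to-one onto its image, uniformly in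
balls.  For `K` in the cell's norm-side MLF setting (proper) and a radius `ρ` with
`ρ·p^{1/(p−1)} < 1` (e.g. `ρ = p⁻²`, or the sharp `ρ = p^{−a}` of Prop. 1.2 (i)):

* `IsTorsionUnit ζ` — `ζⁿ = 1` for some `n ≥ 1` (the elements of `R^μ`);
* `isTorsionUnit_of_norm_one_sub_le` — **`R^μ ∩ (1 + p^λ R) = {1}`**: a root of unity `ζ` with
  `‖1 − ζ‖ ≤ ρ` is `1` (`log_p` is injective there and kills `ζ`);
* `unitLog_sub_norm_le_iff` — **fibres**: for units `u, v`, `‖log_p u − log_p v‖ ≤ ρ` iff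
  `u = ζ·w·v` with `ζ ∈ R^μ` and `‖1 − w‖ ≤ ρ`; in particular (`unitLog_eq_iff`) `log_p u = log_p v` iff
  `u = ζ·v`, `ζ ∈ R^μ`.

So `R^×/(R^μ·U_ρ) ≅ log_p(R^×)/{‖z‖ ≤ ρ}` and `R^μ·U_ρ ≅ R^μ × U_ρ`, which is the counting behind
`μ(log_p(R^×)) = μ(R^×)/|R^μ|` (abc-iut-S2).  Classical; nothing disputed.
-/

noncomputable section

open Filter Metric Set
open _root_.Topology
open IsUltrametricDist

namespace Literature.IUT.LogVolume

open Literature.NumberTheory.Transcendental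

variable (p : ℕ) [Fact p.Prime]
variable (K : Type*) [NontriviallyNormedField K] [instK : NormedAlgebra ℚ_[p] K] [IsUltrametricDist K]
  [ProperSpace K]

/-- `ζ ∈ R^μ`: `ζ` is a root of unity, `ζⁿ = 1` for some `n ≥ 1` ("`R^μ_i ⊆ R^×_i` the torsion subgroup",
[IUTchIV] Prop. 1.4 p. 13). [claim: Mochizuki2012, status: disputed] -/
def IsTorsionUnit (ζ : K) : Prop := ∃ n : ℕ, 0 < n ∧ ζ ^ n = 1

omit instK [IsUltrametricDist K] [ProperSpace K] in
/-- A root of unity has norm `1`. [claim: Mochizuki2012, status: disputed] -/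
theorem IsTorsionUnit.norm_eq_one {ζ : K} (h : IsTorsionUnit K ζ) : ‖ζ‖ = 1 := by
  obtain ⟨n, hn, hζ⟩ := h
  have h1 : ‖ζ‖ ^ n = 1 := by rw [← norm_pow, hζ, norm_one]
  exact (pow_eq_one_iff_of_nonneg (norm_nonneg ζ) hn.ne').mp h1

omit instK [IsUltrametricDist K] [ProperSpace K] in
/-- `1 ∈ R^μ`. [claim: Mochizuki2012, status: disputed] -/
theorem isTorsionUnit_one : IsTorsionUnit K 1 := ⟨1, one_pos, one_pow 1⟩

omit instK [IsUltrametricDist K] [ProperSpace K] in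
/-- `R^μ` is closed under products. [claim: Mochizuki2012, status: disputed] -/
theorem IsTorsionUnit.mul {ζ ξ : K} (hζ : IsTorsionUnit K ζ) (hξ : IsTorsionUnit K ξ) :
    IsTorsionUnit K (ζ * ξ) := by
  obtain ⟨m, hm, h1⟩ := hζ
  obtain ⟨n, hn, h2⟩ := hξ
  refine ⟨m * n, Nat.mul_pos hm hn, ?_⟩
  rw [mul_pow, pow_mul, h1, one_pow, one_mul, mul_comm m n, pow_mul, h2, one_pow]

omit instK [IsUltrametricDist K] [ProperSpace K] in
/-- `R^μ` is closed under inverses. [claim: Mochizuki2012, status: disputed] -/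
theorem IsTorsionUnit.inv {ζ : K} (hζ : IsTorsionUnit K ζ) : IsTorsionUnit K ζ⁻¹ := by
  obtain ⟨n, hn, h1⟩ := hζ
  exact ⟨n, hn, by rw [inv_pow, h1, inv_one]⟩

include instK in
/-- `log_p` vanishes on `R^μ` and only there (among units): restatement of `unitLog_eq_zero_iff`.
[claim: Mochizuki2012, status: disputed] -/
theorem unitLog_eq_zero_iff_isTorsionUnit {u : K} (hu : ‖u‖ = 1) :
    unitLog u = 0 ↔ IsTorsionUnit K u :=
  unitLog_eq_zero_iff p K hu

omit instK [IsUltrametricDist K] [ProperSpace K] in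
/-- A radius with `ρ·p^{1/(p−1)} < 1` is `< 1`. [cite: Koblitz1984, Ch. IV §1] -/
theorem radius_lt_one {ρ : ℝ} (hθ : ρ * (p : ℝ) ^ (1 / ((p : ℝ) - 1)) < 1) {x : K} (hx : ‖x‖ ≤ ρ) :
    ρ < 1 := by
  have hp1 : (1 : ℝ) < p := by exact_mod_cast (Fact.out : p.Prime).one_lt
  have hρ0 : 0 ≤ ρ := (norm_nonneg _).trans hx
  have hq1 : 1 < (p : ℝ) ^ (1 / ((p : ℝ) - 1)) := Real.one_lt_rpow hp1 (div_pos one_pos (by linarith))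
  calc ρ = ρ * 1 := (mul_one ρ).symm
    _ ≤ ρ * (p : ℝ) ^ (1 / ((p : ℝ) - 1)) := by gcongr
    _ < 1 := hθ

include instK in
/-- **`R^μ ∩ (1 + p^λ·R) = {1}`**: a root of unity in the ball `‖1 − ζ‖ ≤ ρ`, `ρ·p^{1/(p−1)} < 1`, is
trivial (`log_p` is injective on the ball and kills `ζ`). [claim: Mochizuki2012, status: disputed] -/
theorem IsTorsionUnit.eq_one_of_norm_one_sub_le {ρ : ℝ} (hθ : ρ * (p : ℝ) ^ (1 / ((p : ℝ) - 1)) < 1)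
    {ζ : K} (hζ : IsTorsionUnit K ζ) (hρ : ‖1 - ζ‖ ≤ ρ) : ζ = 1 := by
  have hρ1 : ρ < 1 := radius_lt_one p K hθ hρ
  obtain ⟨n, hn, h1⟩ := hζ
  have hP : IsPrincipal ζ := hρ.trans_lt hρ1
  have hlog : unitLog ζ = 0 := unitLog_eq_zero_of_pow_eq_one p hn h1
  have hL : logSeries ζ = logSeries (1 : K) := by
    rw [← unitLog_of_isPrincipal p hP, hlog, logSeries_one]
  have h1mem : (1 : K) ∈ {y : K | ‖1 - y‖ ≤ ρ} := by
    simp only [Set.mem_setOf_eq, sub_self, norm_zero]; exact (norm_nonneg _).trans hρ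
  exact logSeries_injOn p K hθ hρ h1mem hL

include instK in
/-- **`log_p u = log_p v ↔ u ∈ R^μ·v`** for units `u, v` (the kernel of `log_p` is `R^μ`).
[claim: Mochizuki2012, status: disputed] -/
theorem unitLog_eq_iff {u v : K} (hu : ‖u‖ = 1) (hv : ‖v‖ = 1) :
    unitLog u = unitLog v ↔ ∃ ζ : K, IsTorsionUnit K ζ ∧ u = ζ * v := by
  have hv0 : v ≠ 0 := norm_pos_iff.mp (by rw [hv]; exact one_pos)
  have hvi : ‖v⁻¹‖ = 1 := by rw [norm_inv, hv, inv_one]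
  constructor
  · intro h
    refine ⟨u * v⁻¹, ?_, by rw [inv_mul_cancel_right₀ hv0]⟩
    have huv : ‖u * v⁻¹‖ = 1 := by rw [norm_mul, hu, hvi, one_mul]
    change ∃ n : ℕ, 0 < n ∧ (u * v⁻¹) ^ n = 1
    rw [← unitLog_eq_zero_iff p K huv, unitLog_mul p hu hvi, unitLog_inv p hv, h, add_neg_cancel]
  · rintro ⟨ζ, hζ, rfl⟩
    have hζ1 : ‖ζ‖ = 1 := hζ.norm_eq_one
    obtain ⟨n, hn, h1⟩ := hζ
    rw [unitLog_mul p hζ1 hv, unitLog_eq_zero_of_pow_eq_one p hn h1, zero_add]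

include instK in
/-- **Fibres of `log_p` over balls**: for units `u, v` and `ρ·p^{1/(p−1)} < 1`,
`‖log_p u − log_p v‖ ≤ ρ ↔ u = ζ·w·v` with `ζ ∈ R^μ`, `‖1 − w‖ ≤ ρ` — i.e. the preimage of the coset
`log_p v + {‖z‖ ≤ ρ}` is the coset `R^μ·U_ρ·v`. [claim: Mochizuki2012, status: disputed] -/
theorem unitLog_sub_norm_le_iff {ρ : ℝ} (hθ : ρ * (p : ℝ) ^ (1 / ((p : ℝ) - 1)) < 1) {u v : K}
    (hu : ‖u‖ = 1) (hv : ‖v‖ = 1) :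
    ‖unitLog u - unitLog v‖ ≤ ρ ↔
      ∃ ζ w : K, IsTorsionUnit K ζ ∧ ‖1 - w‖ ≤ ρ ∧ u = ζ * w * v := by
  have hv0 : v ≠ 0 := norm_pos_iff.mp (by rw [hv]; exact one_pos)
  have hvi : ‖v⁻¹‖ = 1 := by rw [norm_inv, hv, inv_one]
  constructor
  · intro h
    have hρ1 : ρ < 1 := radius_lt_one p K hθ h
    -- `log_p (u v⁻¹) = L(w)` for some `w` in the ball
    have huv : ‖u * v⁻¹‖ = 1 := by rw [norm_mul, hu, hvi, one_mul]
    have hz : ‖unitLog (u * v⁻¹)‖ ≤ ρ := by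
      rwa [unitLog_mul p hu hvi, unitLog_inv p hv, ← sub_eq_add_neg]
    obtain ⟨w, hw, hwz⟩ := exists_logSeries_eq p K hθ hz
    have hwP : IsPrincipal w := hw.trans_lt hρ1
    have hw1 : ‖w‖ = 1 := hwP.norm_eq_one
    have hw0 : w ≠ 0 := norm_pos_iff.mp (by rw [hw1]; exact one_pos)
    have hwi : ‖w⁻¹‖ = 1 := by rw [norm_inv, hw1, inv_one]
    refine ⟨u * v⁻¹ * w⁻¹, w, ?_, hw, ?_⟩
    · have hn : ‖u * v⁻¹ * w⁻¹‖ = 1 := by rw [norm_mul, huv, hwi, one_mul]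
      change ∃ n : ℕ, 0 < n ∧ (u * v⁻¹ * w⁻¹) ^ n = 1
      rw [← unitLog_eq_zero_iff p K hn, unitLog_mul p huv hwi, unitLog_inv p hw1,
        unitLog_of_isPrincipal p hwP, hwz, add_neg_cancel]
    · field_simp
  · rintro ⟨ζ, w, hζ, hw, rfl⟩
    have hρ1 : ρ < 1 := radius_lt_one p K hθ hw
    have hwP : IsPrincipal w := hw.trans_lt hρ1
    have hw1 : ‖w‖ = 1 := hwP.norm_eq_one
    have hζ1 : ‖ζ‖ = 1 := hζ.norm_eq_one
    obtain ⟨n, hn, h1⟩ := hζ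
    have hζw : ‖ζ * w‖ = 1 := by rw [norm_mul, hζ1, hw1, one_mul]
    rw [unitLog_mul p hζw hv, unitLog_mul p hζ1 hw1, unitLog_eq_zero_of_pow_eq_one p hn h1, zero_add,
      add_sub_cancel_right, unitLog_of_isPrincipal p hwP]
    exact (norm_logSeries_le_norm p K hθ.le hw).trans hw

end Literature.IUT.LogVolume

end
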